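import Mathlib
import Summits.QuantumFields.BalabanUV.T4Continuum.Support.NE3CovariantLineSumsL2Tower
import Summits.QuantumFields.BalabanUV.T4Continuum.Support.NE3FramePotBound
import HarnessLib

/-!
# NE3 support, route (H♮) row H4-W (= K5-spk): the crude ℓ² frame bound at a curved background

OWNER's booking ρ-g23-4 (journal l.19443; this lineage's INTENT l.19555): the spike heights of the K6 competitor (S7) are
`s_z = −framePotW L k W η′ z`, so K6 needs the ℓ²(torus) bound of the ACCUMULATED FRAME GENERATOR of the k-fold covariant
average at the background `W` — the curved twin of this lineage's flat `NE3FramePotBound.sum_norm_framePot_sq_le` (H4, `12·Dfp`):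

  `Σ_{z∈periodBox N} ‖framePotW L (j+1) W Y z‖² ≤ 48·Dfp d L · Σ_{x∈periodBox (L^{j+1}·N)} Σ_κ ‖Y x κ‖²`   (`sum_norm_framePotW_sq_le`)

for `3 ≤ d`, `2 ≤ L`, `1 ≤ N`, in the tower's small-field class of the chart (`IsUnitaryCfg W`, `IsPeriodicCfg W (L^{j+1}·N)`,
`0 ≤ x`, `LevelSmall d L j x`, `SmallField W x`, the ℓ² level sum `S2sum d L (j+1) x ≤ ρ∕2` of C1's
`NE3CovariantLineSumsL2Tower`), `(L^{j+1}·N)`-periodic `Y` — k-FREE, N-FREE.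

Proof = the flat proof with isometric transports: §1 the closed form `framePotW L k W Y z = Σ_{m<k} Fbar L (cavgIter L m W)
(QbarIter L m W Y) ((L^{k−1−m})•z)` (`framePotW_eq_sum`, from the tree's `framePotW_succ'`); §2 one block-tree average against the
box, `‖Fbar L U V y‖ ≤ dL·dirL1 V (box (dL) (L•y))` at ANY unitary `U` (`norm_Fbar_le`: `‖dhol U V Γ‖ ≤ Σ_{b∈Γ}‖V b‖`, the tree's
`norm_dhol_le`); §3 the level-`m` field `QbarIter L m W Y` in ℓ²: `≤ 4·(L²∕L^d)^m·‖Y‖²` (`l2sq_QbarIter_le`: C1's straight tower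
`sqrt_l2sq_QstrIter_le` plus its error `sqrt_l2sq_ErrIter_le`, `QbarIter = QstrIter + ErrIter`), periodicity and unitarity down
the tower (`isPeriodicDir_QbarIter`, the tree's `isPeriodicCfg_cavgIter`∕`cavgIter_unitary_small`), the torus bound of one term
(`sum_norm_Fbar_QbarIter_sq_le`, `4·Dfp·(L²∕L^d)^m`); §4 weighted Cauchy–Schwarz with weights `(3∕4)^m` exactly as flat (`48·Dfp`).
Level bookkeeping: `LevelSmall`∕`S2sum` are monotone in the level (`levelSmall_of_le`, `S2sum_le_of_le`).

HONEST: an ℓ² bookkeeping bound on OUR definitions; (P♮)_W, (ML_w) at W ≠ 1, T-E_w, NE3 are NOT proved here; spine 0∕9; finite T⁴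
rung (B)+1 — NOT infinite volume ∕ mass gap ∕ BetaPertH ∕ Clay.  PLACEMENT: `Summits/QuantumFields/BalabanUV/` (cell rule).
-/

set_option autoImplicit false

open scoped BigOperators Matrix.Norms.L2Operator
open Finset

namespace Summit.QuantumFields.BalabanUV.T4Continuum.NE3FramePotBoundW

open Literature.MathematicalPhysics.QuantumFieldTheory.Balaban1983to89
open B7Prop1Explicit B7Prop2Explicit
open T4AveragingDeficitWall (IsUnitaryCfg SmallField dirL1 box)
open T4AveragingDeficitWallBoundary (periodBox IsPeriodicCfg)
open AveragingDeficitPeriodicCounting (IsPeriodicDir sum_periodBox_box_le)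
open AveragingDeficitTransport (lnorm norm_dhol_le)
open AveragingDeficitPlaqLin (lnorm_le_region)
open AveragingDeficitChartCalculus (cavg)
open AveragingDeficitFermat (isPeriodicCfg_cavg)
open AveragingDeficitTwoLevelPrep (prop1Radius)
open AveragingDeficitMultiLevelPrep (cavgIter LevelSmall tower natCast_tower_succ isPeriodicCfg_cavgIter cavgIter_unitary_small)
open BlockAveragePushDirSplit (frameLin sum_blockWeight_eq_one)
open NE3TangentCovariantStructure (Qbar Fbar Qbar_add_period)
open NE3TangentCovariantTower (QbarIter framePotW framePotW_succ' QbarIter_succ QbarIter_zero)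
open NE3CovariantLineSumsTower (QbarIter_eq_QstrIter_add_ErrIter)
open NE3CovariantLineSumsL2 (l2sq l2sq_nonneg dirL1_box_sq_le sqrt_l2sq_add_le)
open NE3CovariantLineSumsL2Tower (rho rho_nonneg delta2 delta2_nonneg S2sum S2sum_succ S2sum_nonneg sqrt_l2sq_QstrIter_le
  sqrt_l2sq_ErrIter_le)
open NE3FramePotBound (Dfp ratio_le geom_sum_le_inv)

noncomputable section

variable {d : ℕ} {n : Type*} [Fintype n] [DecidableEq n]

/-! ## §0 Level bookkeeping -/

omit [Fintype n] [DecidableEq n] in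
/-- `tower L P m = L^m·P`. [folklore] -/
theorem tower_eq_pow_mul (L P : ℕ) : ∀ m : ℕ, tower L P m = L ^ m * P
  | 0 => by simp [tower]
  | m + 1 => by rw [tower, tower_eq_pow_mul L P m, pow_succ]; ring

omit [Fintype n] [DecidableEq n] in
/-- `LevelSmall` descends one level: `LevelSmall (i+1) x → LevelSmall i x`. [folklore] -/
theorem levelSmall_pred {L : ℕ} : ∀ (i : ℕ) {x : ℝ}, LevelSmall d L (i + 1) x → LevelSmall d L i x
  | 0, _, h => h.1
  | i + 1, _, h => ⟨h.1, levelSmall_pred i h.2⟩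

omit [Fintype n] [DecidableEq n] in
/-- `LevelSmall` is monotone in the level: `LevelSmall i x → LevelSmall m x` for `m ≤ i`. [folklore] -/
theorem levelSmall_of_le {L : ℕ} {m i : ℕ} (hmi : m ≤ i) {x : ℝ} (h : LevelSmall d L i x) : LevelSmall d L m x := by
  induction i, hmi using Nat.le_induction with
  | base => exact h
  | succ i _ ih => exact ih (levelSmall_pred i h)

omit [Fintype n] [DecidableEq n] in
/-- `S2sum` grows with the level: `S2sum i x ≤ S2sum (i+1) x` (`x ≥ 0`). [folklore] -/
theorem S2sum_le_succ (L : ℕ) : ∀ (i : ℕ) {x : ℝ}, 0 ≤ x → S2sum d L i x ≤ S2sum d L (i + 1) x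
  | 0, x, hx => by rw [S2sum_succ]; simp only [S2sum, add_zero]; exact delta2_nonneg d L hx
  | i + 1, x, hx => by
      rw [S2sum_succ, S2sum_succ d L (i + 1) x]
      have hx1 : 0 ≤ prop1Radius d L x := by unfold prop1Radius; positivity
      linarith [S2sum_le_succ L i hx1]

omit [Fintype n] [DecidableEq n] in
/-- `S2sum` is monotone in the level: `S2sum m x ≤ S2sum i x` for `m ≤ i` (`x ≥ 0`). [folklore] -/
theorem S2sum_le_of_le (L : ℕ) {m i : ℕ} (hmi : m ≤ i) {x : ℝ} (hx : 0 ≤ x) : S2sum d L m x ≤ S2sum d L i x := by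
  induction i, hmi using Nat.le_induction with
  | base => exact le_rfl
  | succ i _ ih => exact ih.trans (S2sum_le_succ L i hx)

/-- The k-fold linearised average of a periodic direction is periodic: period `tower L P m` at the base gives period `P` after
`m` levels. [folklore] -/
theorem isPeriodicDir_QbarIter (L P : ℕ) : ∀ (m : ℕ) {W : Site d → Fin d → (Matrix n n ℂ)ˣ} {Y : Site d → Fin d → Matrix n n ℂ},
    IsPeriodicCfg W ((tower L P m : ℕ) : ℤ) → IsPeriodicDir Y ((tower L P m : ℕ) : ℤ) → IsPeriodicDir (QbarIter L m W Y) (P : ℤ)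
  | 0, _, _, _, hY => hY
  | m + 1, W, Y, hW, hY => by
      rw [natCast_tower_succ] at hW hY
      rw [QbarIter_succ]
      exact isPeriodicDir_QbarIter L P m (isPeriodicCfg_cavg L _ hW) (fun z i κ => Qbar_add_period L hW hY z i κ)

/-! ## §1 The closed form of the accumulated frame generator -/

/-- **CLOSED FORM**: `framePotW L k W Y z = Σ_{m<k} Fbar L (cavgIter L m W) (QbarIter L m W Y) ((L^{k−1−m})•z)` — the level-`m` linearised
frame of the level-`m` field at the level-`m` background, read at the corner of the big block. [folklore] -/
theorem framePotW_eq_sum (L : ℕ) (W : Site d → Fin d → (Matrix n n ℂ)ˣ) (Y : Site d → Fin d → Matrix n n ℂ) :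
    ∀ (k : ℕ) (z : Site d),
    framePotW L k W Y z = ∑ m ∈ range k, Fbar L (cavgIter L m W) (QbarIter L m W Y) (((L : ℤ) ^ (k - 1 - m)) • z)
  | 0, z => by simp [NE3TangentCovariantTower.framePotW_zero]
  | k + 1, z => by
      rw [framePotW_succ', framePotW_eq_sum L W Y k ((L : ℤ) • z), Finset.sum_range_succ, add_comm]
      congr 1
      · refine Finset.sum_congr rfl fun m hm => ?_
        have hmk : m < k := Finset.mem_range.mp hm
        rw [smul_smul, ← pow_succ, show k - 1 - m + 1 = k + 1 - 1 - m by omega]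
      · rw [show k + 1 - 1 - k = 0 by omega, pow_zero, one_smul]

/-! ## §2 One block-tree average against the box, at any unitary background -/

/-- **ONE LINEARISED FRAME AGAINST THE BOX** (any unitary `U`): `‖Fbar L U V y‖ ≤ dL·dirL1 V (box (dL) (L•y))` — every tree contour has
at most `dL` bonds within l¹-distance `dL` of the corner, the transports are isometries (`norm_dhol_le`), the weights sum to one. [folklore] -/
theorem norm_Fbar_le {L : ℕ} (hL : 1 ≤ L) {U : Site d → Fin d → (Matrix n n ℂ)ˣ} (hU : IsUnitaryCfg U)
    (V : Site d → Fin d → Matrix n n ℂ) (y : Site d) :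
    ‖Fbar L U V y‖ ≤ (d * L : ℝ) * dirL1 V (box (d * L) ((L : ℤ) • y)) := by
  have hwt := sum_blockWeight_eq_one (d := d) L hL
  have hD0 : 0 ≤ dirL1 V (box (d * L) ((L : ℤ) • y)) := by
    unfold dirL1; exact Finset.sum_nonneg fun _ _ => Finset.sum_nonneg fun _ _ => norm_nonneg _
  show ‖frameLin L U V ((L : ℤ) • y)‖ ≤ _
  unfold frameLin
  calc ‖∑ r : Fin d → Fin L, (((L : ℝ) ^ d)⁻¹) • AveragingDeficitTransport.dhol U V ((L : ℤ) • y) (treeWord (boxVec L r))‖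
      ≤ ∑ r : Fin d → Fin L, ‖(((L : ℝ) ^ d)⁻¹) • AveragingDeficitTransport.dhol U V ((L : ℤ) • y) (treeWord (boxVec L r))‖ :=
        norm_sum_le _ _
    _ ≤ ∑ _r : Fin d → Fin L, ((L : ℝ) ^ d)⁻¹ * ((d * L : ℝ) * dirL1 V (box (d * L) ((L : ℤ) • y))) := by
        refine Finset.sum_le_sum fun r _ => ?_
        rw [norm_smul, Real.norm_eq_abs, abs_of_nonneg (by positivity)]
        refine mul_le_mul_of_nonneg_left ?_ (by positivity)
        refine (norm_dhol_le hU V _ _).trans ?_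
        have hlen : (treeWord (boxVec L r)).length ≤ d * L := by rw [length_treeWord]; exact l1_boxVec_le (L := L) r
        have h := lnorm_le_region V (z := (L : ℤ) • y) (q := (L : ℤ) • y) (R := d * L) (treeWord (boxVec L r))
          (by rw [sub_self]; simp only [l1, Pi.zero_apply, Int.natAbs_zero, Finset.sum_const_zero, zero_add]; exact hlen)
        exact h.trans (mul_le_mul_of_nonneg_right (by exact_mod_cast hlen) hD0)
    _ = (d * L : ℝ) * dirL1 V (box (d * L) ((L : ℤ) • y)) := by rw [← Finset.sum_mul, hwt, one_mul]

/-- … squared, by Cauchy–Schwarz on the box: `‖Fbar L U V y‖² ≤ (dL)²·d·(2dL+1)^d·Σ_{x∈box (dL) (L•y)} Σ_κ ‖V x κ‖²`. [folklore] -/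
theorem norm_Fbar_sq_le {L : ℕ} (hL : 1 ≤ L) {U : Site d → Fin d → (Matrix n n ℂ)ˣ} (hU : IsUnitaryCfg U)
    (V : Site d → Fin d → Matrix n n ℂ) (y : Site d) :
    ‖Fbar L U V y‖ ^ 2
      ≤ (d * L : ℝ) ^ 2 * ((d : ℝ) * ((2 * (d * L) + 1 : ℕ) : ℝ) ^ d * ∑ x ∈ box (d * L) ((L : ℤ) • y), ∑ κ : Fin d, ‖V x κ‖ ^ 2) := by
  have h1 := norm_Fbar_le (d := d) hL hU V y
  have h2 := dirL1_box_sq_le (d := d) V (d * L) ((L : ℤ) • y)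
  calc ‖Fbar L U V y‖ ^ 2 ≤ ((d * L : ℝ) * dirL1 V (box (d * L) ((L : ℤ) • y))) ^ 2 := pow_le_pow_left₀ (norm_nonneg _) h1 2
    _ = (d * L : ℝ) ^ 2 * dirL1 V (box (d * L) ((L : ℤ) • y)) ^ 2 := by ring
    _ ≤ _ := mul_le_mul_of_nonneg_left h2 (by positivity)

/-! ## §3 The level-`m` field in ℓ² and one term on the torus -/

/-- **THE k-FOLD LINEARISED AVERAGE IN ℓ²(TORUS)**: in the multi-level small-field class with `S2sum d L (m+1) x ≤ ρ∕2`,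
`l2sq_P (QbarIter L (m+1) W Y) ≤ 4·(L²∕L^d)^{m+1}·l2sq_{tower L P (m+1)} Y` (`QbarIter = QstrIter + ErrIter`, C1's two ℓ² towers,
`ρ + 2·S2sum ≤ 2ρ`). [folklore] -/
theorem l2sq_QbarIter_succ_le [Nonempty n] {L P : ℕ} (hL : 1 ≤ L) (hP : 1 ≤ P) (m : ℕ) {W : Site d → Fin d → (Matrix n n ℂ)ˣ}
    {x : ℝ} (hWu : IsUnitaryCfg W) (hWP : IsPeriodicCfg W ((tower L P (m + 1) : ℕ) : ℤ)) (hx : 0 ≤ x) (hsm : LevelSmall d L m x)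
    (hWx : SmallField W x) (hS : S2sum d L (m + 1) x ≤ rho d L / 2) {Y : Site d → Fin d → Matrix n n ℂ}
    (hY : IsPeriodicDir Y ((tower L P (m + 1) : ℕ) : ℤ)) :
    l2sq (periodBox (d := d) P) (QbarIter L (m + 1) W Y)
      ≤ 4 * ((L : ℝ) ^ 2 / (L : ℝ) ^ d) ^ (m + 1) * l2sq (periodBox (d := d) (tower L P (m + 1))) Y := by
  have hρ := rho_nonneg d L
  set nY : ℝ := Real.sqrt (l2sq (periodBox (d := d) (tower L P (m + 1))) Y) with hnY
  have hnY0 : 0 ≤ nY := Real.sqrt_nonneg _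
  have h1 := sqrt_l2sq_QstrIter_le hL hP m hWu hWP hx hsm hWx hY
  have h2 := sqrt_l2sq_ErrIter_le hL hP m hWu hWP hx hsm hWx hS hY
  have hS0 : 0 ≤ S2sum d L (m + 1) x := S2sum_nonneg d L (m + 1) hx
  have hsum : Real.sqrt (l2sq (periodBox (d := d) P) (QbarIter L (m + 1) W Y)) ≤ 2 * rho d L ^ (m + 1) * nY := by
    rw [QbarIter_eq_QstrIter_add_ErrIter hL m hWu hx hsm hWx Y]
    refine (sqrt_l2sq_add_le _ _ _).trans ((add_le_add h1 h2).trans ?_)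
    have hρm : 0 ≤ rho d L ^ m * nY := by positivity
    rw [pow_succ]
    nlinarith
  have hl0 : 0 ≤ l2sq (periodBox (d := d) P) (QbarIter L (m + 1) W Y) := l2sq_nonneg _ _
  have hρ2 : rho d L ^ 2 = (L : ℝ) ^ 2 / (L : ℝ) ^ d := by
    unfold rho; rw [Real.sq_sqrt (by positivity)]
  calc l2sq (periodBox (d := d) P) (QbarIter L (m + 1) W Y)
      = Real.sqrt (l2sq (periodBox (d := d) P) (QbarIter L (m + 1) W Y)) ^ 2 := (Real.sq_sqrt hl0).symm
    _ ≤ (2 * rho d L ^ (m + 1) * nY) ^ 2 := pow_le_pow_left₀ (Real.sqrt_nonneg _) hsum 2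
    _ = 4 * (rho d L ^ 2) ^ (m + 1) * nY ^ 2 := by ring
    _ = 4 * ((L : ℝ) ^ 2 / (L : ℝ) ^ d) ^ (m + 1) * l2sq (periodBox (d := d) (tower L P (m + 1))) Y := by
        rw [hρ2, hnY, Real.sq_sqrt (l2sq_nonneg _ _)]

/-- The level-`m` field in ℓ², all `m` (the case `m = 0` being trivial): `l2sq_P (QbarIter L m W Y) ≤ 4·(L²∕L^d)^m·l2sq_{L^m·P} Y` under
`LevelSmall d L (m−1) x`-type smallness, here taken from a dominating level `j ≥ m − 1` (monotonicity). [folklore] -/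
theorem l2sq_QbarIter_le [Nonempty n] {L P : ℕ} (hL : 1 ≤ L) (hP : 1 ≤ P) {j : ℕ} (m : ℕ) (hmj : m ≤ j + 1)
    {W : Site d → Fin d → (Matrix n n ℂ)ˣ} {x : ℝ} (hWu : IsUnitaryCfg W) (hWP : IsPeriodicCfg W ((L ^ m * P : ℕ) : ℤ)) (hx : 0 ≤ x)
    (hsm : LevelSmall d L j x) (hWx : SmallField W x) (hS : S2sum d L (j + 1) x ≤ rho d L / 2) {Y : Site d → Fin d → Matrix n n ℂ}
    (hY : IsPeriodicDir Y ((L ^ m * P : ℕ) : ℤ)) :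
    l2sq (periodBox (d := d) P) (QbarIter L m W Y) ≤ 4 * ((L : ℝ) ^ 2 / (L : ℝ) ^ d) ^ m * l2sq (periodBox (d := d) (L ^ m * P)) Y := by
  cases m with
  | zero =>
      rw [QbarIter_zero, pow_zero, mul_one, pow_zero, one_mul]
      have h0 := l2sq_nonneg (periodBox (d := d) P) Y
      linarith
  | succ m =>
      rw [← tower_eq_pow_mul] at hWP hY ⊢
      exact l2sq_QbarIter_succ_le hL hP m hWu hWP hx (levelSmall_of_le (by omega) hsm) hWx
        ((S2sum_le_of_le L (by omega) hx).trans hS) hY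

/-- **ONE TERM ON THE TORUS**: for `j + 1 + m` levels, `z ∈ periodBox N`, the level-`m` frame read at `(L^j)•z`:
`Σ_{z∈periodBox N} ‖Fbar L (cavgIter L m W) (QbarIter L m W Y) ((L^j)•z)‖² ≤ 4·Dfp d L·(L²∕L^d)^m·l2sq (periodBox (L^{j+1+m}·N)) Y`. [folklore] -/
theorem sum_norm_Fbar_QbarIter_sq_le [Nonempty n] {L : ℕ} (hL : 1 ≤ L) {N : ℕ} (hN : 1 ≤ N) (j m : ℕ) {i : ℕ} (hmi : m ≤ i + 1)
    {W : Site d → Fin d → (Matrix n n ℂ)ˣ} {x : ℝ} (hWu : IsUnitaryCfg W) (hWP : IsPeriodicCfg W ((L ^ (j + 1 + m) * N : ℕ) : ℤ))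
    (hx : 0 ≤ x) (hsm : LevelSmall d L i x) (hWx : SmallField W x) (hS : S2sum d L (i + 1) x ≤ rho d L / 2)
    {Y : Site d → Fin d → Matrix n n ℂ} (hY : IsPeriodicDir Y ((L ^ (j + 1 + m) * N : ℕ) : ℤ)) :
    ∑ z ∈ periodBox (d := d) N, ‖Fbar L (cavgIter L m W) (QbarIter L m W Y) (((L : ℤ) ^ j) • z)‖ ^ 2
      ≤ 4 * Dfp d L * ((L : ℝ) ^ 2 / (L : ℝ) ^ d) ^ m * l2sq (periodBox (d := d) (L ^ (j + 1 + m) * N)) Y := by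
  set U : Site d → Fin d → (Matrix n n ℂ)ˣ := cavgIter L m W with hU
  set V : Site d → Fin d → Matrix n n ℂ := QbarIter L m W Y with hV
  set R : ℕ := d * L with hR
  set g : Site d → ℝ := fun y => ∑ κ : Fin d, ‖V y κ‖ ^ 2 with hg
  have hPe : L ^ (j + 1 + m) * N = L ^ m * (L ^ (j + 1) * N) := by ring
  -- the level-`m` background is unitary, the level-`m` field is `(L^{j+1}·N)`-periodic
  have hUu : IsUnitaryCfg U := by
    cases m with
    | zero => exact hWu
    | succ m => exact (cavgIter_unitary_small hL m hWu hx (levelSmall_of_le (by omega) hsm) hWx).1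
  have hWPt : IsPeriodicCfg W ((tower L (L ^ (j + 1) * N) m : ℕ) : ℤ) := by rw [tower_eq_pow_mul, ← hPe]; exact hWP
  have hYt : IsPeriodicDir Y ((tower L (L ^ (j + 1) * N) m : ℕ) : ℤ) := by rw [tower_eq_pow_mul, ← hPe]; exact hY
  have hVP : IsPeriodicDir V ((L ^ (j + 1) * N : ℕ) : ℤ) := isPeriodicDir_QbarIter L _ m hWPt hYt
  have hgP : ∀ (y : Site d) (τ : Fin d), g (y + ((L ^ (j + 1) * N : ℕ) : ℤ) • e τ) = g y := fun y τ => by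
    simp only [hg]; exact Finset.sum_congr rfl fun κ _ => by rw [hVP y τ κ]
  have hg0 : ∀ y, 0 ≤ g y := fun y => by rw [hg]; positivity
  -- pointwise, with the centre `L•(L^j•z) = (L^{j+1})•z`
  have hLj : 1 ≤ L ^ (j + 1) := Nat.one_le_pow _ _ hL
  have hpt : ∀ z : Site d, ‖Fbar L U V (((L : ℤ) ^ j) • z)‖ ^ 2
      ≤ (d * L : ℝ) ^ 2 * ((d : ℝ) * ((2 * R + 1 : ℕ) : ℝ) ^ d * ∑ y ∈ box R (((L ^ (j + 1) : ℕ) : ℤ) • z), g y) := by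
    intro z
    have h := norm_Fbar_sq_le (d := d) hL hUu V (((L : ℤ) ^ j) • z)
    have e : (L : ℤ) • (((L : ℤ) ^ j) • z) = (((L ^ (j + 1) : ℕ) : ℤ)) • z := by
      rw [smul_smul]; congr 1; push_cast; ring
    rw [e] at h
    simpa only [hR, hg] using h
  have hbox := sum_periodBox_box_le (L ^ (j + 1)) N hLj hN R hg0 hgP
  have hl2 := l2sq_QbarIter_le (d := d) hL (P := L ^ (j + 1) * N)
    (Nat.one_le_iff_ne_zero.mpr (Nat.mul_ne_zero (pow_ne_zero _ (by omega)) (by omega))) m hmi hWu (by rw [← hPe]; exact hWP)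
    hx hsm hWx hS (Y := Y) (by rw [← hPe]; exact hY)
  have hl2' : ∑ y ∈ periodBox (d := d) (L ^ (j + 1) * N), g y
      ≤ 4 * ((L : ℝ) ^ 2 / (L : ℝ) ^ d) ^ m * l2sq (periodBox (d := d) (L ^ (j + 1 + m) * N)) Y := by
    have e : ∑ y ∈ periodBox (d := d) (L ^ (j + 1) * N), g y = l2sq (periodBox (d := d) (L ^ (j + 1) * N)) V := by rw [hg]; rfl
    rw [e, hV, hPe]
    exact hl2
  have hD : (0 : ℝ) ≤ (d * L : ℝ) ^ 2 * ((d : ℝ) * ((2 * R + 1 : ℕ) : ℝ) ^ d) := by positivity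
  calc ∑ z ∈ periodBox (d := d) N, ‖Fbar L U V (((L : ℤ) ^ j) • z)‖ ^ 2
      ≤ ∑ z ∈ periodBox (d := d) N, (d * L : ℝ) ^ 2 * ((d : ℝ) * ((2 * R + 1 : ℕ) : ℝ) ^ d * ∑ y ∈ box R (((L ^ (j + 1) : ℕ) : ℤ) • z), g y) :=
        Finset.sum_le_sum fun z _ => hpt z
    _ = (d * L : ℝ) ^ 2 * ((d : ℝ) * ((2 * R + 1 : ℕ) : ℝ) ^ d) * ∑ z ∈ periodBox (d := d) N, ∑ y ∈ box R (((L ^ (j + 1) : ℕ) : ℤ) • z), g y := by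
        rw [Finset.mul_sum]; exact Finset.sum_congr rfl fun z _ => by ring
    _ ≤ (d * L : ℝ) ^ 2 * ((d : ℝ) * ((2 * R + 1 : ℕ) : ℝ) ^ d) * (((2 * R + 1 : ℕ) : ℝ) ^ d * ∑ y ∈ periodBox (d := d) (L ^ (j + 1) * N), g y) := by
        refine mul_le_mul_of_nonneg_left ?_ hD
        exact_mod_cast hbox
    _ ≤ (d * L : ℝ) ^ 2 * ((d : ℝ) * ((2 * R + 1 : ℕ) : ℝ) ^ d)
          * (((2 * R + 1 : ℕ) : ℝ) ^ d * (4 * ((L : ℝ) ^ 2 / (L : ℝ) ^ d) ^ m * l2sq (periodBox (d := d) (L ^ (j + 1 + m) * N)) Y)) :=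
        mul_le_mul_of_nonneg_left (mul_le_mul_of_nonneg_left hl2' (by positivity)) hD
    _ = 4 * Dfp d L * ((L : ℝ) ^ 2 / (L : ℝ) ^ d) ^ m * l2sq (periodBox (d := d) (L ^ (j + 1 + m) * N)) Y := by
        simp only [Dfp, hR]; ring

/-! ## §4 The k-free frame bound at a curved background -/

/-- **H4-W — THE CRUDE ℓ² FRAME BOUND AT A CURVED BACKGROUND**: for `3 ≤ d`, `2 ≤ L`, `1 ≤ N`, a unitary `(L^{j+1}·N)`-periodic `W` in the
tower's small-field class (`0 ≤ x`, `LevelSmall d L j x`, `SmallField W x`, `S2sum d L (j+1) x ≤ ρ∕2`) and an `(L^{j+1}·N)`-periodic `Y`: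
`Σ_{z∈periodBox N} ‖framePotW L (j+1) W Y z‖² ≤ 48·Dfp d L·Σ_{x∈periodBox (L^{j+1}·N)} Σ_κ ‖Y x κ‖²` — k-FREE, N-FREE (the level-`m` term carries
`4·(L²∕L^d)^m ≤ 4·2^{−m}`; weighted Cauchy–Schwarz with weights `(3∕4)^m`, as at the flat background). [folklore] -/
theorem sum_norm_framePotW_sq_le [Nonempty n] (hd : 3 ≤ d) {L : ℕ} (hL : 2 ≤ L) {N : ℕ} (hN : 1 ≤ N) (j : ℕ)
    {W : Site d → Fin d → (Matrix n n ℂ)ˣ} {x : ℝ} (hWu : IsUnitaryCfg W) (hWP : IsPeriodicCfg W ((L ^ (j + 1) * N : ℕ) : ℤ))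
    (hx : 0 ≤ x) (hsm : LevelSmall d L j x) (hWx : SmallField W x) (hS : S2sum d L (j + 1) x ≤ rho d L / 2)
    {Y : Site d → Fin d → Matrix n n ℂ} (hY : IsPeriodicDir Y ((L ^ (j + 1) * N : ℕ) : ℤ)) :
    ∑ z ∈ periodBox (d := d) N, ‖framePotW L (j + 1) W Y z‖ ^ 2 ≤ 48 * Dfp d L * l2sq (periodBox (d := d) (L ^ (j + 1) * N)) Y := by
  have hL1 : 1 ≤ L := by omega
  have hD0 : 0 ≤ Dfp d L := by unfold Dfp; positivity
  have hS0 : 0 ≤ l2sq (periodBox (d := d) (L ^ (j + 1) * N)) Y := l2sq_nonneg _ _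
  set k : ℕ := j + 1 with hk
  have hkpos : 0 < k := by omega
  -- notation: the terms `a m z` and the weights `w m = (3/4)^m`
  set ρ2 : ℝ := (L : ℝ) ^ 2 / (L : ℝ) ^ d with hρ2
  have hρ0 : 0 ≤ ρ2 := by rw [hρ2]; positivity
  have hρq : ρ2 * (4 / 3) ≤ 2 / 3 := ratio_le (d := d) hd hL
  set a : ℕ → Site d → ℝ := fun m z => ‖Fbar L (cavgIter L m W) (QbarIter L m W Y) (((L : ℤ) ^ (k - 1 - m)) • z)‖ with ha
  set w : ℕ → ℝ := fun m => (3 / 4 : ℝ) ^ m with hw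
  have hwpos : ∀ m ∈ range k, 0 < w m := fun m _ => by rw [hw]; positivity
  have hwsum : ∑ m ∈ range k, w m ≤ 4 := by
    have := geom_sum_le_inv (q := (3 / 4 : ℝ)) (by norm_num) (by norm_num) k
    simpa [hw] using this.trans (by norm_num)
  have hwsum0 : 0 < ∑ m ∈ range k, w m := Finset.sum_pos hwpos ⟨0, Finset.mem_range.mpr hkpos⟩
  -- (1) pointwise: `‖framePotW‖ ≤ Σ_m a m z` and Sedrakyan
  have hpt : ∀ z : Site d, ‖framePotW L k W Y z‖ ^ 2 ≤ 4 * ∑ m ∈ range k, a m z ^ 2 / w m := by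
    intro z
    have h1 : ‖framePotW L k W Y z‖ ≤ ∑ m ∈ range k, a m z := by
      rw [framePotW_eq_sum]; exact norm_sum_le _ _
    have h2 := Finset.sq_sum_div_le_sum_sq_div (range k) (fun m => a m z) hwpos
    have h3 : (∑ m ∈ range k, a m z) ^ 2 ≤ (∑ m ∈ range k, w m) * ∑ m ∈ range k, a m z ^ 2 / w m := by
      rw [div_le_iff₀ hwsum0] at h2; linarith [h2]
    have h4 : 0 ≤ ∑ m ∈ range k, a m z ^ 2 / w m :=
      Finset.sum_nonneg fun m hm => div_nonneg (sq_nonneg _) (hwpos m hm).le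
    calc ‖framePotW L k W Y z‖ ^ 2 ≤ (∑ m ∈ range k, a m z) ^ 2 := pow_le_pow_left₀ (norm_nonneg _) h1 2
      _ ≤ (∑ m ∈ range k, w m) * ∑ m ∈ range k, a m z ^ 2 / w m := h3
      _ ≤ 4 * ∑ m ∈ range k, a m z ^ 2 / w m := mul_le_mul_of_nonneg_right hwsum h4
  -- (2) the torus sum of each weighted term
  have hterm : ∀ m ∈ range k, ∑ z ∈ periodBox (d := d) N, a m z ^ 2 / w m
      ≤ 4 * Dfp d L * (2 / 3 : ℝ) ^ m * l2sq (periodBox (d := d) (L ^ k * N)) Y := by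
    intro m hm
    have hmk : m < k := Finset.mem_range.mp hm
    have hjm : k - 1 - m + 1 + m = k := by omega
    have hWP' : IsPeriodicCfg W ((L ^ (k - 1 - m + 1 + m) * N : ℕ) : ℤ) := by rw [hjm]; exact hWP
    have hY' : IsPeriodicDir Y ((L ^ (k - 1 - m + 1 + m) * N : ℕ) : ℤ) := by rw [hjm]; exact hY
    have h := sum_norm_Fbar_QbarIter_sq_le (d := d) hL1 hN (k - 1 - m) m (i := j) (by omega) hWu hWP' hx hsm hWx hS hY'
    rw [hjm] at h
    rw [← Finset.sum_div]
    have hw' : w m = (3 / 4 : ℝ) ^ m := rfl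
    rw [div_le_iff₀ (hwpos m hm), hw']
    have hD4 : 0 ≤ 4 * Dfp d L := by positivity
    calc ∑ z ∈ periodBox (d := d) N, a m z ^ 2 ≤ 4 * Dfp d L * ρ2 ^ m * l2sq (periodBox (d := d) (L ^ k * N)) Y := h
      _ ≤ 4 * Dfp d L * ((2 / 3 : ℝ) ^ m * (3 / 4 : ℝ) ^ m)⁻¹⁻¹ * l2sq (periodBox (d := d) (L ^ k * N)) Y := by
          rw [inv_inv]
          refine mul_le_mul_of_nonneg_right (mul_le_mul_of_nonneg_left ?_ hD4) hS0
          rw [← mul_pow]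
          exact pow_le_pow_left₀ hρ0 (by nlinarith) m
      _ = 4 * Dfp d L * (2 / 3 : ℝ) ^ m * l2sq (periodBox (d := d) (L ^ k * N)) Y * (3 / 4 : ℝ) ^ m := by rw [inv_inv]; ring
  -- (3) assemble
  have hgeo : ∑ m ∈ range k, (2 / 3 : ℝ) ^ m ≤ 3 := by
    have := geom_sum_le_inv (q := (2 / 3 : ℝ)) (by norm_num) (by norm_num) k
    exact this.trans (by norm_num)
  calc ∑ z ∈ periodBox (d := d) N, ‖framePotW L k W Y z‖ ^ 2
      ≤ ∑ z ∈ periodBox (d := d) N, 4 * ∑ m ∈ range k, a m z ^ 2 / w m := Finset.sum_le_sum fun z _ => hpt z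
    _ = 4 * ∑ m ∈ range k, ∑ z ∈ periodBox (d := d) N, a m z ^ 2 / w m := by rw [← Finset.mul_sum, Finset.sum_comm]
    _ ≤ 4 * ∑ m ∈ range k, 4 * Dfp d L * (2 / 3 : ℝ) ^ m * l2sq (periodBox (d := d) (L ^ k * N)) Y :=
        mul_le_mul_of_nonneg_left (Finset.sum_le_sum hterm) (by norm_num)
    _ = 16 * (Dfp d L * l2sq (periodBox (d := d) (L ^ k * N)) Y) * ∑ m ∈ range k, (2 / 3 : ℝ) ^ m := by
        simp only [Finset.mul_sum]; exact Finset.sum_congr rfl fun m _ => by ring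
    _ ≤ 16 * (Dfp d L * l2sq (periodBox (d := d) (L ^ k * N)) Y) * 3 :=
        mul_le_mul_of_nonneg_left hgeo (by positivity)
    _ = 48 * Dfp d L * l2sq (periodBox (d := d) (L ^ k * N)) Y := by ring

end

end Summit.QuantumFields.BalabanUV.T4Continuum.NE3FramePotBoundW
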